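import Summits.BirchSwinnertonDyer.Rank1Residual.X2.NonPrimitiveLambdaShiftRat
import Summits.BirchSwinnertonDyer.Rank1Residual.X2.NonPrimitiveLambdaInvariantMultiplicativeOfDatum
import Summits.BirchSwinnertonDyer.Rank1Residual.X2.NonPrimitiveLambdaInvariantMultiplicativeDerived
import HarnessLib
/-!
# GV (6)–(7) at an odd multiplicative prime, UPPER HALF, with NO datum record and NO trivial-zero
# record: `λ(Sel^{Σ₀}_E(ℚ_∞)_p) ≤ λ(Sel_E(ℚ_∞)_p) + Σ_{v∈Σ₀} δ_E^{(v)}` for BAD `Σ₀ ∌ p` (+ f.g.,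
# torsion, `μ` equal), from A40/A41 only — cell `b2b-bsdres`, unit `b2b-bsdres-eisenstein-p2`,
# gen 30 (F7-0)

HONEST FRAMING (run/shared/lean/b2b/bsd-rank1-residual/, verbatim in every file): the goal of the
cell is to DELETE the COMBINATION-SHAPED residual classes of the Birch–Swinnerton-Dyer formula for
ALL analytic-rank `≤ 1` elliptic curves over `ℚ` — "full BSD formula for every rank `≤ 1` curve in
class `C`" assembled STRICTLY from published theorems — so that the rank-`≤ 1` remainder becomes
exactly the CONSTRUCTION-SHAPED classes, which are TYPED (missing-input `Prop`s), NOT attempted.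
This is not "finishing BSD". Research route; NO CLAIM BEYOND STATED CLASSES; nothing here changes a
label. Theorems only; no definition, no named fact, no `sorry`.

WHAT. Gen 26 (`NonPrimitiveLambdaInvariantMultiplicativeOfDatum`, `…SplitOfDatum`, `…Derived`)
derived the registered fact A133 (`lambda_nonPrimitive_eq_add_sum_delta_multiplicative`:
`λ(Sel^{Σ₀}) = λ(Sel) + Σδ` at `p ‖ N`) from the datum record T-GV23L (`h23`) and, at a split prime,
the infinitude of the trivial-zero quotient A137′ (`hInf`). Programme P1 (X2-GAP §34–§35) proved the
UPPER HALF of the datum record in the kernel for BAD `Σ₀`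
(`NonPrimitiveLambdaShiftRat.lambdaInvariant_le_add_sum_delta_of_not_good`, from A40/A41). This
file transports it to the classical duals:

* `NonPrimitiveLambdaLeMultiplicative.lambda_nonPrimitive_le_add_sum_delta_of_not_split` —
  NON-split `p`: gen 26's transport (`Sel = S_A`, `Sel^{Σ₀} = S^{Σ₀}_A` for the Tate data of
  `exists_data_of_not_split`) fed with the kernel theorem instead of `h23`;
* `NonPrimitiveLambdaLeSplit.invariants_le_of_split`,
  `NonPrimitiveLambdaLeSplit.lambda_nonPrimitive_le_add_sum_delta_of_split` — SPLIT `p`: the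
  classical groups are the STRICT datum groups; `λ(X(S_A)) = λ(D) + c_∅`,
  `λ(X(S^{Σ₀}_A)) = λ(DS) + c_{Σ₀}` (`invariants_of_restrictionMap`), the kernel bound, and
  `c_∅ ≤ c_{Σ₀}` (both `≤ 1`; `S_A/S^{str} ↪ S^{Σ₀}_A/S^{Σ₀,str}` by `infinite_quotient_mono`) —
  NO infinitude (A137′) needed for the inequality;
* **`NonPrimitiveLambdaLeSplit.lambda_nonPrimitive_le_add_sum_delta_multiplicative`** — split OR
  non-split: for `E/ℚ` globally minimal, `p` odd multiplicative, `κ` cyclotomic, BAD `Σ₀ ∌ p`, f.g.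
  torsion `D` and any `DS`: `DS` f.g. torsion, `μ(DS) = μ(D)`, `λ(DS) ≤ λ(D) + Σ_{v∈Σ₀} δ_E^{(v)}` —
  the `≤` half of A133 for bad `Σ₀`, from A40/A41 ONLY (no T-GV23L, no A137′).

References: [GreenbergVatsal2000] §1 (5)–(7), §2 pp. 14–16, 20, Cor. (2.3), Prop. (2.4), p. 26;
[SilvermanATAEC1994] V.3.1, V.5.2–5.4; [GreenbergLNM1716] §1 p. 60, §2 p. 76; HOME X2-GAP.md §35.
-/

set_option autoImplicit false

noncomputable section

open scoped Classical AddSubgroup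

namespace Summit.BirchSwinnertonDyer.Rank1Residual.X2.NonPrimitiveLambdaLeMultiplicative

open NumberField IsDedekindDomain Field WeierstrassCurve
  Literature.NumberTheory.EllipticCurves Literature.NumberTheory.EllipticCurves.GreenbergSelmer
  Literature.NumberTheory.EllipticCurves.GreenbergVatsal2000
  Literature.NumberTheory.GaloisRepresentations
  Summit.BirchSwinnertonDyer.Rank1Residual.X2.GreenbergVatsalTateDatumCofree
  Summit.BirchSwinnertonDyer.Rank1Residual.X2.GreenbergVatsalTransferMultiplicative
  Summit.BirchSwinnertonDyer.Rank1Residual.X2.NonPrimitiveLambdaInvariantOfDatum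

/-- **GV (6)–(7) at an odd NON-SPLIT `p ‖ N`, upper half, NO datum record**: `DS` is f.g. and
torsion, `μ(DS) = μ(D)`, and `λ(DS) ≤ λ(D) + Σ_{v∈S₀} δ_E^{(v)}` for BAD `S₀ ∌ p` — gen 26's transport
(`Sel = S_A(ℚ_∞)`, `Sel^{Σ₀} = S^{Σ₀}_A(ℚ_∞)` for the Tate data of `exists_data_of_not_split`) fed
with the kernel theorem `NonPrimitiveLambdaShiftRat.lambdaInvariant_le_add_sum_delta_of_not_good`
instead of `h23`. [cite: GreenbergVatsal2000, §1 (5)–(7) pp. 7–8; pp. 14–15; §2 Cor. (2.3), Prop. (2.4) (pp. 20–22); p. 26]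
[cite: SilvermanATAEC1994, Ch. V Lemma 5.2 (c), Thm. 5.3 (a),(b), Cor. 5.4] -/
theorem lambda_nonPrimitive_le_add_sum_delta_of_not_split
    (hT : Silverman1994_thmV53_tateUniformisation.{0})
    (hT' : Silverman1994_thmV53_corV54_tateUniformisation.{0})
    (W : WeierstrassCurve ℚ) [W.IsElliptic] [W.IsGloballyMinimal] (p : ℕ) [Fact p.Prime]
    (hp2 : p ≠ 2) (hmult : W.HasMultiplicativeReductionAtPrime p)
    (hns : ¬ W.HasSplitMultiplicativeReductionAtPrime p)
    (κ : ZpExtension ℚ p) (hκ : κ.IsCyclotomic) (γ : absoluteGaloisGroup ℚ)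
    (hγ : κ.IsTopGenerator γ) (S₀ : Finset (HeightOneSpectrum (𝓞 ℚ)))
    (hS₀ : ∀ v ∈ S₀, ((p : ℕ) : 𝓞 ℚ) ∉ v.asIdeal) (hbad : ∀ v ∈ S₀, ¬ W.HasGoodReductionAt v)
    (D : W.SelmerDualData κ γ) [Module.Finite (IwasawaAlgebra p) D.X]
    (DS : NonPrimitiveDualData W κ γ (↑S₀ : Set (HeightOneSpectrum (𝓞 ℚ))))
    (hX : D.IsTorsion) :
    Module.Finite (IwasawaAlgebra p) DS.X ∧ Module.IsTorsion (IwasawaAlgebra p) DS.X ∧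
      muInvariant p DS.X = muInvariant p D.X ∧
      lambdaInvariant p DS.X ≤ lambdaInvariant p D.X + ∑ v ∈ S₀, delta W p v := by
  -- the Tate data above `p` with all its properties (A41)
  obtain ⟨L, -, -, -, hgs, hls, hsl⟩ := exists_data_of_not_split W p κ hT' hκ hp2 hmult hns
  have hRD : ∀ (v : HeightOneSpectrum (𝓞 ℚ)) (hv : ((p : ℕ) : 𝓞 ℚ) ∈ v.asIdeal),
      (L v hv).greenbergKer κ.kerSubgroup = W.localKerOver p κ.kerSubgroup (v.adicCompletion ℚ) :=
    fun v hv ↦ (hgs v hv).trans (le_antisymm (hsl v hv) (hls v hv))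
  -- classical = datum, primitive and non-primitive
  have hSel : W.selmerInfty κ = datumSelmerInfty κ (W.geomPrimaryTorsion p) L ∅ :=
    Additive.selmerInfty_eq_datumSelmerInfty W p κ hp2 hκ L hRD
  have hNP : nonPrimitiveSelmerInfty W κ (↑S₀ : Set (HeightOneSpectrum (𝓞 ℚ))) =
      datumSelmerInfty κ (W.geomPrimaryTorsion p) L (↑S₀ : Set (HeightOneSpectrum (𝓞 ℚ))) :=
    Additive.nonPrimitiveSelmerInfty_eq_datumSelmerInfty W p κ _ hp2 hκ L hRD
      (fun v hv ↦ hS₀ v (Finset.mem_coe.1 hv))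
  -- transport the duals, apply the kernel upper bound, transport back
  obtain ⟨X, ⟨eX⟩⟩ := exists_datumDualData_of_selmerDualData W D hSel
  obtain ⟨X₀, ⟨eX₀⟩⟩ := exists_datumDualData_of_nonPrimitiveDualData W DS hNP
  haveI : Module.Finite (IwasawaAlgebra p) X.X := Module.Finite.equiv eX.symm
  have hXt : Module.IsTorsion (IwasawaAlgebra p) X.X :=
    isTorsion_of_injective eX.toLinearMap eX.injective hX
  obtain ⟨hfg, htors, hμ, hlam⟩ :=
    NonPrimitiveLambdaShiftRat.lambdaInvariant_le_add_sum_delta_of_not_good W κ hT hT' hp2 hκ hγ L S₀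
      hS₀ hbad X hXt X₀
  haveI := hfg
  refine ⟨Module.Finite.equiv eX₀, isTorsion_of_injective eX₀.symm.toLinearMap eX₀.symm.injective htors,
    ?_, ?_⟩
  · rw [← muInvariant_eq_of_linearEquiv eX₀, hμ, muInvariant_eq_of_linearEquiv eX]
  · rw [← lambdaInvariant_eq_of_linearEquiv eX₀, ← lambdaInvariant_eq_of_linearEquiv eX]
    exact hlam

end Summit.BirchSwinnertonDyer.Rank1Residual.X2.NonPrimitiveLambdaLeMultiplicative

namespace Summit.BirchSwinnertonDyer.Rank1Residual.X2.NonPrimitiveLambdaLeSplit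

open NumberField IsDedekindDomain Field WeierstrassCurve
  Literature.NumberTheory.EllipticCurves Literature.NumberTheory.EllipticCurves.GreenbergSelmer
  Literature.NumberTheory.EllipticCurves.GreenbergVatsal2000
  Literature.NumberTheory.EllipticCurves.IwasawaDual
  Literature.NumberTheory.GaloisRepresentations
  Summit.BirchSwinnertonDyer.Rank1Residual.X2.GreenbergVatsalTorsion
  Summit.BirchSwinnertonDyer.Rank1Residual.X2.GreenbergVatsalStrictSelmer
  Summit.BirchSwinnertonDyer.Rank1Residual.X2.GreenbergVatsalTateDatumCofree
  Summit.BirchSwinnertonDyer.Rank1Residual.X2.DualRestrictionSelmer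
  Summit.BirchSwinnertonDyer.Rank1Residual.X2.TrivialZeroQuotientCorank
  Summit.BirchSwinnertonDyer.Rank1Residual.X2.NonPrimitiveLambdaInvariantSplitOfDatum

section Split

variable (W : WeierstrassCurve ℚ) [W.IsElliptic] [W.IsGloballyMinimal] (p : ℕ) [hp : Fact p.Prime]
  (κ : ZpExtension ℚ p) {γ : absoluteGaloisGroup ℚ}

/-- **GV (6)–(7) at an odd SPLIT `p ‖ N`, upper half**, for Tate data `L` above `p` with `C`
divisible, `#C[p] = p`, `D_v`-trivial quotient and `strictKer = localKerOver` (as supplied by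
`exists_data_of_split`), BAD `Σ₀ ∌ p`, f.g. torsion `D` (dual of `Sel`) and any `DS` (dual of
`Sel^{Σ₀}`): `DS` f.g. torsion, `μ(DS) = μ(D)`, `λ(DS) ≤ λ(D) + Σ_{v∈S₀} δ_E^{(v)}`. Proof:
`λ(X(S_A)) = λ(D) + c_∅`, `λ(X(S^{Σ₀}_A)) = λ(DS) + c_{Σ₀}` (`invariants_of_restrictionMap` over the
strict = classical groups), `λ(X(S^{Σ₀}_A)) ≤ λ(X(S_A)) + Σδ` (kernel), and `c_∅ ≤ c_{Σ₀}` (both `≤ 1`;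
if `c_∅ ≠ 0` the quotient `S_A/S^{str}` is infinite, hence so is `S^{Σ₀}/S^{Σ₀,str}`, whose corank is
then `1`). [cite: GreenbergVatsal2000, §1 (5)–(7) pp. 7–8; pp. 14–16; §2 Cor. (2.3), Prop. (2.4), p. 26]
[cite: GreenbergLNM1716, §1 p. 60; §2 p. 76] -/
theorem invariants_le_of_split (hT : Silverman1994_thmV53_tateUniformisation.{0})
    (hT' : Silverman1994_thmV53_corV54_tateUniformisation.{0})
    (hp2 : p ≠ 2) (hκ : κ.IsCyclotomic) (hγ : κ.IsTopGenerator γ)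
    (L : Data ℚ (W.geomPrimaryTorsion p) p)
    (hC : ∀ (v : HeightOneSpectrum (𝓞 ℚ)) (hv : ((p : ℕ) : 𝓞 ℚ) ∈ v.asIdeal),
      (∀ c ∈ (L v hv).plus, ∃ c' ∈ (L v hv).plus, p • c' = c) ∧
        Nat.card ↥((L v hv).plus ⊓ (↥(W.geomPrimaryTorsion p))[(p : ℤ)]) = p)
    (htrivD : ∀ (v : HeightOneSpectrum (𝓞 ℚ)) (hv : ((p : ℕ) : 𝓞 ℚ) ∈ v.asIdeal),
      ∀ (δ : decomp (K := ℚ) v) (d : (L v hv).Gr), δ • d = d)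
    (hRD : ∀ (v : HeightOneSpectrum (𝓞 ℚ)) (hv : ((p : ℕ) : 𝓞 ℚ) ∈ v.asIdeal),
      (L v hv).strictKer κ.kerSubgroup = W.localKerOver p κ.kerSubgroup (v.adicCompletion ℚ))
    (S₀ : Finset (HeightOneSpectrum (𝓞 ℚ))) (hS₀ : ∀ v ∈ S₀, ((p : ℕ) : 𝓞 ℚ) ∉ v.asIdeal)
    (hbad : ∀ v ∈ S₀, ¬ W.HasGoodReductionAt v)
    (D : W.SelmerDualData κ γ) [Module.Finite (IwasawaAlgebra p) D.X]
    (DS : NonPrimitiveDualData W κ γ (↑S₀ : Set (HeightOneSpectrum (𝓞 ℚ)))) (hX : D.IsTorsion) :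
    Module.Finite (IwasawaAlgebra p) DS.X ∧ Module.IsTorsion (IwasawaAlgebra p) DS.X ∧
      muInvariant p DS.X = muInvariant p D.X ∧
      lambdaInvariant p DS.X ≤ lambdaInvariant p D.X + ∑ v ∈ S₀, delta W p v := by
  have hS₀' : ∀ v ∈ (↑S₀ : Set (HeightOneSpectrum (𝓞 ℚ))), ((p : ℕ) : 𝓞 ℚ) ∉ v.asIdeal :=
    fun v hv ↦ hS₀ v (Finset.mem_coe.1 hv)
  -- the classical groups are the strict datum groups
  have hSel : W.selmerInfty κ = gvStrictSelmerInfty κ (W.geomPrimaryTorsion p) L ∅ :=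
    selmerInfty_eq_gvStrictSelmerInfty_of_strictKer_eq W p κ hp2 hκ L hRD
  have hNP : nonPrimitiveSelmerInfty W κ (↑S₀ : Set (HeightOneSpectrum (𝓞 ℚ))) =
      gvStrictSelmerInfty κ (W.geomPrimaryTorsion p) L ↑S₀ :=
    nonPrimitiveSelmerInfty_eq_gvStrictSelmerInfty_of_strictKer_eq W p κ _ hp2 hκ L hRD hS₀'
  have hTS : W.selmerInfty κ ≤ datumSelmerInfty κ (W.geomPrimaryTorsion p) L ∅ := by
    rw [hSel]; exact gvStrictSelmerInfty_le_gvSelmerInfty κ _ L ∅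
  have hTS₀ : nonPrimitiveSelmerInfty W κ (↑S₀ : Set (HeightOneSpectrum (𝓞 ℚ))) ≤
      datumSelmerInfty κ (W.geomPrimaryTorsion p) L ↑S₀ := by
    rw [hNP]; exact gvStrictSelmerInfty_le_gvSelmerInfty κ _ L _
  -- finiteness of the `p`-torsion of the two trivial-zero quotients, and their coranks `≤ 1`
  haveI : Finite ((↥(datumSelmerInfty κ (W.geomPrimaryTorsion p) L ∅) ⧸
      (W.selmerInfty κ).addSubgroupOf (datumSelmerInfty κ (W.geomPrimaryTorsion p) L ∅))[(p : ℤ)]) := by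
    rw [hSel]; exact (finite_torsionBy_quotient_and_zpCorank_le W p κ L ∅ hκ hC htrivD).1
  haveI : Finite ((↥(datumSelmerInfty κ (W.geomPrimaryTorsion p) L ↑S₀) ⧸
      (nonPrimitiveSelmerInfty W κ (↑S₀ : Set (HeightOneSpectrum (𝓞 ℚ)))).addSubgroupOf
        (datumSelmerInfty κ (W.geomPrimaryTorsion p) L ↑S₀))[(p : ℤ)]) := by
    rw [hNP]; exact (finite_torsionBy_quotient_and_zpCorank_le W p κ L _ hκ hC htrivD).1
  have hce : zpCorank (↥(datumSelmerInfty κ (W.geomPrimaryTorsion p) L ∅) ⧸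
      (W.selmerInfty κ).addSubgroupOf (datumSelmerInfty κ (W.geomPrimaryTorsion p) L ∅)) p ≤
      zpCorank (↥(datumSelmerInfty κ (W.geomPrimaryTorsion p) L ↑S₀) ⧸
        (nonPrimitiveSelmerInfty W κ (↑S₀ : Set (HeightOneSpectrum (𝓞 ℚ)))).addSubgroupOf
          (datumSelmerInfty κ (W.geomPrimaryTorsion p) L ↑S₀)) p := by
    rw [hSel, hNP]
    change zpCorank (↥(gvSelmerInfty κ (W.geomPrimaryTorsion p) L ∅) ⧸
        (gvStrictSelmerInfty κ (W.geomPrimaryTorsion p) L ∅).addSubgroupOf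
          (gvSelmerInfty κ (W.geomPrimaryTorsion p) L ∅)) p ≤
      zpCorank (↥(gvSelmerInfty κ (W.geomPrimaryTorsion p) L ↑S₀) ⧸
        (gvStrictSelmerInfty κ (W.geomPrimaryTorsion p) L ↑S₀).addSubgroupOf
          (gvSelmerInfty κ (W.geomPrimaryTorsion p) L ↑S₀)) p
    have hleE := (finite_torsionBy_quotient_and_zpCorank_le W p κ L ∅ hκ hC htrivD).2
    rcases Nat.eq_zero_or_pos (zpCorank (↥(gvSelmerInfty κ (W.geomPrimaryTorsion p) L ∅) ⧸
      (gvStrictSelmerInfty κ (W.geomPrimaryTorsion p) L ∅).addSubgroupOf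
        (gvSelmerInfty κ (W.geomPrimaryTorsion p) L ∅)) p) with h0 | hpos
    · rw [h0]; exact Nat.zero_le _
    · -- `c_∅ ≠ 0`: the quotient for `∅` is infinite, hence so is the one for `Σ₀`, of corank `1`
      haveI hfinE := (finite_torsionBy_quotient_and_zpCorank_le W p κ L ∅ hκ hC htrivD).1
      haveI : Infinite (↥(gvSelmerInfty κ (W.geomPrimaryTorsion p) L ∅) ⧸
          (gvStrictSelmerInfty κ (W.geomPrimaryTorsion p) L ∅).addSubgroupOf
            (gvSelmerInfty κ (W.geomPrimaryTorsion p) L ∅)) := by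
        rw [← not_finite_iff_infinite]
        intro hfinQ
        have h0 := zpCorank_of_finite_eq_zero (A := ↥(gvSelmerInfty κ (W.geomPrimaryTorsion p) L ∅) ⧸
          (gvStrictSelmerInfty κ (W.geomPrimaryTorsion p) L ∅).addSubgroupOf
            (gvSelmerInfty κ (W.geomPrimaryTorsion p) L ∅)) p
        omega
      haveI : Infinite (↥(gvSelmerInfty κ (W.geomPrimaryTorsion p) L ↑S₀) ⧸
          (gvStrictSelmerInfty κ (W.geomPrimaryTorsion p) L ↑S₀).addSubgroupOf
            (gvSelmerInfty κ (W.geomPrimaryTorsion p) L ↑S₀)) :=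
        infinite_quotient_mono κ (W.geomPrimaryTorsion p) L _
      have h1 := zpCorank_quotient_eq_one_of_infinite W p κ L (↑S₀ : Set (HeightOneSpectrum (𝓞 ℚ)))
        hκ hC htrivD
      rw [h1]; exact hleE
  -- the dual of `S_A`: f.g. torsion, `μ = μ(D)`, `λ = λ(D) + c_∅`
  have hφT : ∀ t : W.selmerInfty κ,
      ((W.conjSelmerInfty κ γ t : W.selmerInfty κ) : subgroupH1 κ.kerSubgroup (W.geomPrimaryTorsion p)) =
        conjH1 κ.kerSubgroup (W.geomPrimaryTorsion p) γ t :=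
    fun t ↦ rfl
  obtain ⟨hfg, hXt⟩ := moduleFinite_and_isTorsion_datumDualData_empty_of_split W p κ hp2 hκ hγ L hC
    htrivD hRD D hX
  haveI := hfg
  obtain ⟨-, -, hμ, hlam⟩ := invariants_of_restrictionMap W κ hγ L ∅ hTS (W.conjSelmerInfty κ γ) hφT
    (W.isLocNil_conjSelmerInfty_sub_one κ hγ) D.toDual D.bijective (fun y t ↦ D.toDual_T_smul y t)
    D.toDual_C_smul hXt
  -- the kernel upper bound for the canonical datum duals
  obtain ⟨hfg₀, htors₀, hμ₀, hlam₀⟩ :=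
    NonPrimitiveLambdaShiftRat.lambdaInvariant_le_add_sum_delta_of_not_good W κ hT hT' hp2 hκ hγ L S₀
      hS₀ hbad (datumDualData W κ L ∅ hγ) hXt (datumDualData W κ L ↑S₀ hγ)
  haveI := hfg₀
  -- the dual of `S^{Σ₀}_A` over `DS.X`: f.g., torsion, `μ` equal, `λ = λ(DS) + c_{Σ₀}`
  have hφT₀ : ∀ t : nonPrimitiveSelmerInfty W κ (↑S₀ : Set (HeightOneSpectrum (𝓞 ℚ))),
      ((NonPrimitiveSelmerDual.conjNonPrimitive W κ _ γ t : nonPrimitiveSelmerInfty W κ _) :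
        subgroupH1 κ.kerSubgroup (W.geomPrimaryTorsion p)) =
          conjH1 κ.kerSubgroup (W.geomPrimaryTorsion p) γ t :=
    fun t ↦ rfl
  obtain ⟨hfgS, htorsS, hμS, hlamS⟩ := invariants_of_restrictionMap W κ hγ L ↑S₀ hTS₀
    (NonPrimitiveSelmerDual.conjNonPrimitive W κ _ γ) hφT₀
    (NonPrimitiveSelmerDual.isLocNil_conjNonPrimitive_sub_one W κ _ hγ) DS.toDual DS.bijective
    (fun y t ↦ DS.toDual_T_smul y t) DS.toDual_C_smul htors₀
  refine ⟨hfgS, htorsS, ?_, ?_⟩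
  · rw [← hμS, hμ₀, hμ]
  · rw [hlamS, hlam] at hlam₀
    omega

/-- **GV (6)–(7) at an odd SPLIT `p ‖ N`, upper half, from A40/A41 only** (Tate data from
`exists_data_of_split`; BAD `Σ₀ ∌ p`). [cite: GreenbergVatsal2000, §1 (5)–(7) pp. 7–8; pp. 14–16; §2 Cor. (2.3), Prop. (2.4), p. 26]
[cite: SilvermanATAEC1994, Ch. V Thm. 3.1 (c),(d) p. 423 and §V.5 Thm. 5.3 (a),(b)] -/
theorem lambda_nonPrimitive_le_add_sum_delta_of_split
    (hT : Silverman1994_thmV53_tateUniformisation.{0})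
    (hT' : Silverman1994_thmV53_corV54_tateUniformisation.{0})
    (hp2 : p ≠ 2) (hsplit : W.HasSplitMultiplicativeReductionAtPrime p)
    (hκ : κ.IsCyclotomic) (hγ : κ.IsTopGenerator γ) (S₀ : Finset (HeightOneSpectrum (𝓞 ℚ)))
    (hS₀ : ∀ v ∈ S₀, ((p : ℕ) : 𝓞 ℚ) ∉ v.asIdeal) (hbad : ∀ v ∈ S₀, ¬ W.HasGoodReductionAt v)
    (D : W.SelmerDualData κ γ) [Module.Finite (IwasawaAlgebra p) D.X]
    (DS : NonPrimitiveDualData W κ γ (↑S₀ : Set (HeightOneSpectrum (𝓞 ℚ)))) (hX : D.IsTorsion) :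
    Module.Finite (IwasawaAlgebra p) DS.X ∧ Module.IsTorsion (IwasawaAlgebra p) DS.X ∧
      muInvariant p DS.X = muInvariant p D.X ∧
      lambdaInvariant p DS.X ≤ lambdaInvariant p D.X + ∑ v ∈ S₀, delta W p v := by
  obtain ⟨L, -, -, hC, htrivD, hls, hsl⟩ := exists_data_of_split W p κ hT hp2 hsplit
  have hRD := strictKer_eq_of_le_of_le W p κ L hls hsl
  exact invariants_le_of_split W p κ hT hT' hp2 hκ hγ L hC htrivD hRD S₀ hS₀ hbad D DS hX

end Split

/-- **GV (5)–(7) at an odd `p ‖ N`, UPPER HALF, from A40/A41 ONLY** — the `≤` half of the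
registered fact `lambda_nonPrimitive_eq_add_sum_delta_multiplicative` (A133) for BAD `Σ₀`: for the
globally minimal `E/ℚ`, `p` odd of multiplicative reduction (split or not), the cyclotomic `κ` with
topological generator `γ`, a finite set `S₀` of BAD places `∌ p`, a f.g. torsion dual datum `D` of
`Sel_E(ℚ_∞)_p` and a dual datum `DS` of `Sel^{Σ₀}_E(ℚ_∞)_p`: `DS` is f.g. and torsion,
`μ(DS) = μ(D)` and **`λ(DS) ≤ λ(D) + Σ_{v∈S₀} δ_E^{(v)}`**. No T-GV23L, no A137′.
[cite: GreenbergVatsal2000, §1 (5)–(7) pp. 7–8; pp. 14–16; §2 Cor. (2.3), Prop. (2.4) (pp. 20–22); p. 26; Remark (2.10)]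
[cite: SilvermanATAEC1994, Ch. V Thm. 3.1, Lemma 5.2, Thm. 5.3, Cor. 5.4] -/
theorem lambda_nonPrimitive_le_add_sum_delta_multiplicative
    (hT : Silverman1994_thmV53_tateUniformisation.{0})
    (hT' : Silverman1994_thmV53_corV54_tateUniformisation.{0})
    (W : WeierstrassCurve ℚ) [W.IsElliptic] [W.IsGloballyMinimal] (p : ℕ) [Fact p.Prime]
    (hp2 : p ≠ 2) (hmult : W.HasMultiplicativeReductionAtPrime p)
    (κ : ZpExtension ℚ p) (hκ : κ.IsCyclotomic) (γ : absoluteGaloisGroup ℚ)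
    (hγ : κ.IsTopGenerator γ) (S₀ : Finset (HeightOneSpectrum (𝓞 ℚ)))
    (hS₀ : ∀ v ∈ S₀, ((p : ℕ) : 𝓞 ℚ) ∉ v.asIdeal) (hbad : ∀ v ∈ S₀, ¬ W.HasGoodReductionAt v)
    (D : W.SelmerDualData κ γ) [Module.Finite (IwasawaAlgebra p) D.X]
    (DS : NonPrimitiveDualData W κ γ (↑S₀ : Set (HeightOneSpectrum (𝓞 ℚ)))) (hX : D.IsTorsion) :
    Module.Finite (IwasawaAlgebra p) DS.X ∧ Module.IsTorsion (IwasawaAlgebra p) DS.X ∧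
      muInvariant p DS.X = muInvariant p D.X ∧
      lambdaInvariant p DS.X ≤ lambdaInvariant p D.X + ∑ v ∈ S₀, delta W p v := by
  by_cases hsplit : W.HasSplitMultiplicativeReductionAtPrime p
  · exact lambda_nonPrimitive_le_add_sum_delta_of_split W p κ hT hT' hp2 hsplit hκ hγ S₀ hS₀ hbad D DS hX
  · exact NonPrimitiveLambdaLeMultiplicative.lambda_nonPrimitive_le_add_sum_delta_of_not_split hT hT' W p
      hp2 hmult hsplit κ hκ γ hγ S₀ hS₀ hbad D DS hX

end Summit.BirchSwinnertonDyer.Rank1Residual.X2.NonPrimitiveLambdaLeSplit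

end
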